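import Mathlib.Analysis.Distribution.SchwartzSpace.Basic
import Mathlib.Analysis.Fourier.FourierTransform
import Mathlib.MeasureTheory.Integral.IntervalIntegral.Basic
import Literature.NumberTheory.LFunctions.NymanBeurlingVectors
import HarnessLib

/-!
# Burnol, *On Fourier and Zeta(s)* (Forum Math. 16 (2004) 789–840): the co-Poisson formula

RH-FREE. Literature corpus typing (statements first) of J.-F. Burnol, *On Fourier and Zeta(s)*,
Forum Math. **16** (2004), 789–840 = arXiv:math/0112254 [bib key `Burnol2004`], §§2–5.
Locators `Thm n.m (TeX l. N)` refer to the arXiv TeX of record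
(`rh-crit/dbl/src/Burnol2004ForumMath_arXivmath0112254.tex`; theorem counter shared by
Theorem/Proposition/Lemma/Definition/Note within each section, so the numbering is the printed
one). WHAT THIS IS NOT: typing a printed theorem is transcription; the one RH-EQUIVALENT statement
of §2 (Thm 2.7, adelic causality) is only inventoried below, never used; nothing here bears on the
truth of RH.

## What is typed here (the statements printed on `ℝ`, i.e. `K = ℚ` at the real place)

Burnol's operators on even functions on `ℝ` (§4, TeX l. 1287–1310):
* `CoPoisson.inv α y = α(1/y)/|y|` — the inversion `I`;
* `CoPoisson.coSum α y = Σ_{n ≥ 1} α(y/n)/n − ∫_0^∞ α(u) du/u` — the **co-Poisson summation**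
  `P'(α)` (= `E'_ℝ(g)` of Thm 3.9 for `K = ℚ`);
* `CoPoisson.muntzSum α y = Σ_{n ≥ 1} α(ny) − (∫_0^∞ α(u) du)/|y|` — the Müntz-modified Poisson
  summation `P(α)` (Note 2.5, TeX l. 737; §4, TeX l. 1300), `P' = I P I`;
* `CoPoisson.IsTestAway α` — "`α` smooth, even, with compact support away from the origin";
  `CoPoisson.IsTestAway2 g` — the same with class `C²` (Thms 4.5/4.6).

Named facts (`def … : Prop`, cite tags with TeX line):
* `Burnol2004_thm_3_8` — Thm 3.8 (TeX l. 1040) on `ℝ`: `P'(α)` is square-integrable and equals the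
  constant `−∫_0^∞ α(u)du/u` near `0`;
* `Burnol2004_thm_3_9` — Thm 3.9 (TeX l. 1137, label `copoisson`): `P'(α)` is an even Schwartz
  function, constant near `0` together with its Fourier transform, and `𝓕(P'(α)) = P'(I(α))`;
* `Burnol2004_lemma_4_1` — Lemma 4.1 (TeX l. 1207): for `g` even measurable with
  `∫_0^∞ |g(u)| du/u < ∞`, `Σ g(t/n)/n` converges absolutely a.e., is locally integrable and
  `∫_0^u (Σ …) = O(u)` (hence a tempered distribution);
* `Burnol2004_thm_4_2` — Thm 4.2 (TeX l. 1235, label `copoissongeneral`): the co-Poisson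
  intertwining `𝓕(Σ g(t/n)/n − ∫_0^∞ g(u)du/u) = Σ g(n/t)/|t| − ∫_0^∞ g(u)du` as an identity of
  tempered distributions, typed in the unfolded weak form `∀ φ ∈ 𝓢(ℝ,ℂ), ∫ A·𝓕φ = ∫ B·φ`
  (Mathlib's `TemperedDistribution` has `𝓕 T φ = T (𝓕 φ)` by definition, so this is literally
  the printed identity; the continuity of `φ ↦ ∫ Aφ` is part of Lemma 4.1);
* `Burnol2004_thm_4_4` — Thm 4.4 (TeX l. 1287): `𝓕(P'(α)) = P'(I(α))` for `α` smooth even with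
  compact support away from `0`;
* `Burnol2004_thm_4_5` — Thm 4.5 (TeX l. 1415, "proven jointly with Luis Báez-Duarte") =
  Thm 4.6 (TeX l. 1504, "proven jointly with Bernard Candelpergher"; the printed statements are
  word-for-word identical, the proofs differ): for `g` even of class `C²` with compact support
  away from `0` both sides are continuous `L¹` functions and the intertwining holds pointwise.
* `burnolV3`, `Burnol2004_thm_5_3_spectral` (PROVED) — Thm 5.3 (TeX l. 1977) "the real unitary
  operator `IV` satisfies `(IV)² = 1`", in the spectral form of its printed proof:
  `V(s)V(1−s) = 1` and `|V| = 1` on the critical line, `V(s) = (s/(1−s))³ ζ(1−s)/ζ(s)`.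

Fourier convention: Burnol's `𝓕(φ)(y) = ∫ φ(x) e^{2πixy} dx` (TeX l. 1148), on even functions the
cosine transform `𝓕₊`; Mathlib's `𝓕 f (w) = ∫ e^{−2πi vw} f(v) dv` agrees with it on even `f`, and
all functions here are even.

## Cited, not restated

* Thm 5.1 (TeX l. 1778, `[aim]`) "`liminf |log λ| D(λ)² ≥ Σ_ρ m_ρ²/|ρ|²`" is Burnol 2002 Thm 1.3 =
  `Literature.Barriers.RiemannHypothesis.Burnol2002_thm1_3` (PROVED:
  `Literature.Barriers.RiemannHypothesis.Burnol2002_thm1_3_holds`).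
* The functional equation `ζ(1−s) = gammaRatio(s) ζ(s)` and `|gammaRatio| = 1` on the line are
  `Literature.NumberTheory.LFunctions.BurnolVectors.riemannZeta_one_sub_eq` /
  `….BurnolVectors.norm_gammaRatio_line` (Burnol's `χ₊(s) = γ₊(1−s)`, §6, TeX l. 2168).

## Inventory of the statements NOT typed here (adelic / local-field language beyond the
## current Mathlib: Bruhat–Schwartz functions, `L²` of the idele class group, adelic Fourier
## transform, Lax–Phillips scattering) — GAP rows for rh-crit-dag, no specialisation invented

* Thm 2.1 (TeX l. 506, `[conductor][cras1]`): the generalized eigenvalues of the conductor operator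
  `H_ν = log|x|_ν + log|y|_ν` on `L²(K_ν)` are `(d/ds) log Γ(χ_ν,s)`:
  `H_ν(χ_ν(x)^{-1}|x|_ν^{-s}) = (d/ds log Γ(χ_ν,s)) χ_ν(x)^{-1}|x|_ν^{-s}`.
* Thm 2.2 (TeX l. 534, `[conductor]`): `Z(g,χ) = Σ_ν ∫_{Re s = 1/2} (d/ds log Γ(χ_ν,s)) ĝ(s)|ds|/2π`.
* Thm 2.3 (TeX l. 559, `[conductor][cras1]`): `Z(g,χ) = Σ_ν H_ν(g_{χ,ν})(1)`,
  `g_{χ,ν}(x) = χ_ν(x)^{-1} g(|x|_ν)`.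
* Thm 2.4 (TeX l. 583): `H_ν I_ν = I_ν H_ν`, equivalently `I_ν log|y|_ν I_ν = 2 log|x|_ν + log|y|_ν`.
* Thm 2.6 (TeX l. 762, `[jnt]` = Burnol, J. Number Theory 87 (2001)): `E(φ) ∈ L²(C_K, d*u)` for
  Bruhat–Schwartz `φ`, its multiplicative Fourier transform is the Tate `L`-function on the critical
  line, the `E(φ)` are dense, `E(𝓕φ) = I(E(φ))`.
* Thm 2.7 (TeX l. 783, `[jnt]`) — RH-EQUIVALENT (for all abelian `L`-functions of `K`): `D₊`, `D₋`
  are outgoing/incoming for a Lax–Phillips scattering on `L²(C_K)`; GRH for `K` ⟺ `D₊ ⊥ D₋`.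
  (Inventory only; the primary source is t5's `BurnolAdelicCausality` assignment.)
* Def 3.1 (TeX l. 878), Thm 3.3 (TeX l. 908): adelic co-Poisson `E'(g)`, `𝓕(E'(g)) = E'(I(g))`,
  equivariance, `K^×`-invariance; Thm 3.6 (TeX l. 964) and Thm 3.7 (TeX l. 1006): the Riemann–Tate
  formulas for `E'(g)(φ)` over `|v| ≥ 1`, resp. `|v| ≤ 1`.
* Thm 5.5 (TeX l. 2008): the vectors `Y^λ_{w,k} = V⁻¹ Q_λ V(|log t|^k t^{-w} 𝟙_{0<t<1})`,
  `Re w < 1/2`, continue analytically (in `L²`) to `ℂ ∖ {1}`, and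
  `[B, Y^λ_{w,k}] = (d/dw)^k B̂(1−w)` for `B ∈ M_Λ` — needs the `L²(0,∞)` realisation of
  `V = (−L)³𝓕₊I` (the tree's `Literature.NumberTheory.LFunctions.BurnolVectors` works on the Mellin
  side with the exponent `6`); not typed.
* §6 (Sonine spaces `K_λ`, Def 6.1, Thm 6.3, Props 6.6/6.7, Thm 6.8 `[cras2]`): typed separately
  over the Sonine-space definition of the de Branges/Sonine module (rh-crit dbl S9).

## References

* J.-F. Burnol, *On Fourier and Zeta(s)*, Forum Math. 16 (2004), no. 6, 789–840,
  doi:10.1515/form.2004.16.6.789; arXiv:math/0112254. [cite: Burnol2004, §§2–5]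
* J.-F. Burnol, *A lower bound in an approximation problem involving the zeros of the Riemann zeta
  function*, Adv. Math. 170 (2002), 56–70 (Thm 5.1 = its Thm 1.3). [cite: Burnol2002, Thm. 1.3]
* E. C. Titchmarsh, *The Theory of the Riemann Zeta-Function*, §2.11 (Müntz's formula).
-/

noncomputable section

open Complex MeasureTheory Set Filter SchwartzMap FourierTransform
open scoped Real Topology ContDiff

namespace Literature.NumberTheory.LFunctions

namespace CoPoisson

/-! ## The operators `I`, `P'` (co-Poisson) and `P` (Müntz–Poisson) on even functions -/

/-- Burnol's inversion `I(α)(y) = α(1/y)/|y|` (§3 Thm 3.9, TeX l. 1153; §4 Thm 4.4, TeX l. 1296),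
a unitary involution of `L²(ℝ)` commuting with nothing but the dilations; here as a plain map on
functions `ℝ → ℂ` (junk value `α(0)/0 = 0` at `y = 0`). [cite: Burnol2004, Thm 4.4 (TeX l. 1296)] -/
def inv (α : ℝ → ℂ) (y : ℝ) : ℂ :=
  α y⁻¹ / ((|y| : ℝ) : ℂ)

/-- The **co-Poisson summation** `P'(α)(y) = Σ_{n ≥ 1} α(y/n)/n − ∫_0^∞ α(u) du/u`
(Burnol 2004, Thm 3.9 / Thm 4.4; the sum is written as a `tsum` over `n : ℕ` of the terms at
`n + 1`, the integral as a Bochner integral over `(0,∞)`). [cite: Burnol2004, Thm 4.4 (TeX l. 1287–1296)] -/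
def coSum (α : ℝ → ℂ) (y : ℝ) : ℂ :=
  (∑' n : ℕ, α (y / ((n : ℝ) + 1)) / ((n : ℂ) + 1)) - ∫ u in Ioi (0 : ℝ), α u / (u : ℂ)

/-- The **Müntz-modified Poisson summation** `P(α)(y) = Σ_{n ≥ 1} α(ny) − (∫_0^∞ α(u) du)/|y|`
(Note 2.5, TeX l. 737–760: "it is in truth not the original Poisson summation but the
Müntz-modified Poisson … which corresponds to `ζ(s)` as multiplier"; §4, TeX l. 1300–1306,
`P' = I·P·I`). [cite: Burnol2004, Note 2.5 (TeX l. 737) and §4 (TeX l. 1300)] -/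
def muntzSum (α : ℝ → ℂ) (y : ℝ) : ℂ :=
  (∑' n : ℕ, α (((n : ℝ) + 1) * y)) - (∫ u in Ioi (0 : ℝ), α u) / ((|y| : ℝ) : ℂ)

/-- The right-hand side of the co-Poisson intertwining as printed,
`Σ_{n ≥ 1} g(n/t)/|t| − ∫_0^∞ g(u) du` (Thm 4.2 / 4.5; for `t > 0` the paper writes `g(n/t)/t`,
all functions being even; this is `P'(I(g))`, cf. `coSum_inv`-type bookkeeping in the proofs
file). [cite: Burnol2004, Thm 4.2 (TeX l. 1235)] -/
def coSumDual (g : ℝ → ℂ) (t : ℝ) : ℂ :=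
  (∑' n : ℕ, g (((n : ℝ) + 1) / t)) / ((|t| : ℝ) : ℂ) - ∫ u in Ioi (0 : ℝ), g u

/-- `I` is an involution away from `0`: `I(I(α))(y) = α(y)` for `y ≠ 0` (used as `I·I = 1` in
the operator proof `𝓕P' = 𝓕IPI = P𝓕II = P𝓕 = IP = P'I`, TeX l. 1306–1310).
[cite: Burnol2004, proof of Thm 4.4 (TeX l. 1308)] -/
theorem inv_inv_apply (α : ℝ → ℂ) {y : ℝ} (hy : y ≠ 0) : inv (inv α) y = α y := by
  simp only [inv, inv_inv, abs_inv, Complex.ofReal_inv]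
  have h : ((|y| : ℝ) : ℂ) ≠ 0 := by exact_mod_cast (abs_pos.2 hy).ne'
  field_simp

/-- "`α` smooth, even, with compact support away from the origin" (the test functions of
Thms 3.9 and 4.4, TeX l. 1147 and l. 1288). [cite: Burnol2004, Thm 4.4 (TeX l. 1288)] -/
structure IsTestAway (α : ℝ → ℂ) : Prop where
  /-- `α ∈ C^∞(ℝ)`. -/
  contDiff : ContDiff ℝ ∞ α
  /-- `α` is even. -/
  even : ∀ y, α (-y) = α y
  /-- `α` has compact support … -/
  hasCompactSupport : HasCompactSupport α
  /-- … away from the origin. -/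
  zero_notMem_tsupport : (0 : ℝ) ∉ tsupport α

/-- "`g` an (even) function of class `C²` which has compact support away from the origin" (the
test functions of Thms 4.5/4.6, TeX l. 1416 and l. 1505). [cite: Burnol2004, Thm 4.5 (TeX l. 1416)] -/
structure IsTestAway2 (g : ℝ → ℂ) : Prop where
  /-- `g ∈ C²(ℝ)`. -/
  contDiff : ContDiff ℝ 2 g
  /-- `g` is even. -/
  even : ∀ y, g (-y) = g y
  /-- `g` has compact support … -/
  hasCompactSupport : HasCompactSupport g
  /-- … away from the origin. -/
  zero_notMem_tsupport : (0 : ℝ) ∉ tsupport g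

end CoPoisson

open CoPoisson

/-! ## §3: the co-Poisson summation on `ℝ` (Thms 3.8, 3.9) -/

/-- **Burnol 2004, Theorem 3.8** (TeX l. 1040), the statement on `ℝ`: "The co-Poisson summation
`E'_ℝ(g)` is a square-integrable function (with respect to the Lebesgue measure). The `L²(ℝ)`
function `E'_ℝ(g)` is equal to the constant `−∫_{𝔸^×} g(v)|v|^{-1/2} d^*v` in a neighborhood of
the origin." By the proof (TeX l. 1089–1103) `E'_ℝ(g)(y) = Σ_{n≥1} α(y/n)/n − ∫_0^∞ α(y)dy/y =
P'(α)(y)` with `α(y) = (f(y)+f(−y))/(2√|y|)` smooth with compact support away from `0`, and the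
constant is `−∫_0^∞ α(y) dy/y`; typed for every such `α` (the passage `g ↦ α` from a compact
Bruhat–Schwartz function on the ideles of `ℚ` is adelic bookkeeping not modelled here).
RH-FREE. [cite: Burnol2004, Thm 3.8 (TeX l. 1040)] -/
def Burnol2004_thm_3_8 : Prop :=
  ∀ α : ℝ → ℂ, IsTestAway α →
    MemLp (coSum α) 2 (volume : Measure ℝ) ∧
      ∀ᶠ y in 𝓝 (0 : ℝ), coSum α y = -∫ u in Ioi (0 : ℝ), α u / (u : ℂ)

/-- **Burnol 2004, Theorem 3.9** (TeX l. 1137, label `copoisson`), the statement on `ℝ`: "The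
co-Poisson summation `E'_ℝ(g)` is an even function on `ℝ` in the Schwartz class of rapidly
decreasing functions. It is constant, as well as its Fourier Transform, in a neighborhood of the
origin. It may be written as `E'_ℝ(g)(y) = Σ_{n≥1} α(y/n)/n − ∫_0^∞ α(y)dy/y` with a function
`α(y)` smooth with compact support away from the origin […]. The Fourier transform
`∫_ℝ E'_ℝ(g)(y) exp(i2πwy) dy` corresponds in the formula above to the replacement
`α(y) ↦ α(1/y)/|y|`." Typed for every smooth even `α` with compact support away from `0`
(the clause "conversely each such formula corresponds to the co-Poisson summation `E'_ℝ(g)` of a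
compact Bruhat–Schwartz function on the ideles of `ℚ`" is adelic bookkeeping, not modelled); the
two constants are those of Thm 3.8 and of the intertwining (`−∫_0^∞ α(u)du/u` and `−∫_0^∞ α`).
RH-FREE. [cite: Burnol2004, Thm 3.9 (TeX l. 1137)] -/
def Burnol2004_thm_3_9 : Prop :=
  ∀ α : ℝ → ℂ, IsTestAway α →
    (∃ φ : 𝓢(ℝ, ℂ), (φ : ℝ → ℂ) = coSum α) ∧
    (∀ y : ℝ, coSum α (-y) = coSum α y) ∧
    (∀ᶠ y in 𝓝 (0 : ℝ), coSum α y = -∫ u in Ioi (0 : ℝ), α u / (u : ℂ)) ∧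
    (∀ᶠ w in 𝓝 (0 : ℝ), 𝓕 (coSum α) w = -∫ u in Ioi (0 : ℝ), α u) ∧
    𝓕 (coSum α) = coSum (inv α)

/-! ## §4: co-Poisson intertwining (Lemma 4.1, Thms 4.2, 4.4, 4.5 = 4.6) -/

/-- **Burnol 2004, Lemma 4.1** (TeX l. 1207): "Let `g(u)` be an even measurable function with
`∫_0^∞ |g(u)| du/u < ∞`. The sum `Σ_{n≥1} g(t/n)/n` is Lebesgue almost-everywhere absolutely
convergent. It is a locally integrable function of `t`. It is a tempered distribution." The last
clause is typed through the estimate of the printed proof (TeX l. 1228–1232): "`∫_0^u A(t)dt` is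
`O(u)`. So the continuous function `∫_0^u A(t)dt` is a tempered distribution. Hence its
distributional derivative `A(u)` is again a tempered distribution." RH-FREE.
[cite: Burnol2004, Lemma 4.1 (TeX l. 1207)] -/
def Burnol2004_lemma_4_1 : Prop :=
  ∀ g : ℝ → ℂ, Measurable g → (∀ u, g (-u) = g u) →
    IntegrableOn (fun u : ℝ ↦ g u / (u : ℂ)) (Ioi 0) →
      (∀ᵐ t : ℝ, Summable fun n : ℕ ↦ ‖g (t / ((n : ℝ) + 1)) / ((n : ℂ) + 1)‖) ∧
      LocallyIntegrable (fun t : ℝ ↦ ∑' n : ℕ, g (t / ((n : ℝ) + 1)) / ((n : ℂ) + 1)) ∧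
      (fun u : ℝ ↦ ∫ t in (0 : ℝ)..u, ∑' n : ℕ, g (t / ((n : ℝ) + 1)) / ((n : ℂ) + 1))
        =O[atTop] fun u ↦ u

/-- **Burnol 2004, Theorem 4.2** (TeX l. 1235, label `copoissongeneral`): "Let `g(t)` be an even
measurable function with `∫_0^∞ |g(t)| dt/t + ∫_0^∞ |g(t)| dt < ∞`. Then the co-Poisson
intertwining `𝓕(Σ_{n≥1} g(t/n)/n − ∫_0^∞ g(u)du/u) = Σ_{n≥1} g(n/t)/t − ∫_0^∞ g(u)du` holds as
an identity of tempered distributions." Typed in the unfolded weak form: for every Schwartz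
`φ`, both pairings converge absolutely and `∫ P'(g)·𝓕φ = ∫ (Σ g(n/t)/|t| − ∫g)·φ` (Mathlib:
`TemperedDistribution.fourier_apply`, `𝓕 T φ = T (𝓕 φ)`). RH-FREE.
[cite: Burnol2004, Thm 4.2 (TeX l. 1235)] -/
def Burnol2004_thm_4_2 : Prop :=
  ∀ g : ℝ → ℂ, Measurable g → (∀ u, g (-u) = g u) →
    IntegrableOn (fun u : ℝ ↦ g u / (u : ℂ)) (Ioi 0) → IntegrableOn g (Ioi 0) →
      ∀ φ : 𝓢(ℝ, ℂ),
        Integrable (fun y : ℝ ↦ coSum g y * 𝓕 (φ : ℝ → ℂ) y) ∧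
        Integrable (fun t : ℝ ↦ coSumDual g t * φ t) ∧
        ∫ y : ℝ, coSum g y * 𝓕 (φ : ℝ → ℂ) y = ∫ t : ℝ, coSumDual g t * φ t

/-- **Burnol 2004, Theorem 4.4** (TeX l. 1287) — the co-Poisson intertwining: "Let `α(y)` be a
smooth even function on `ℝ` with compact support away from the origin. Let `P'(α)` be its
co-Poisson summation: `P'(α)(y) = Σ_{n≥1} α(y/n)/n − ∫_0^∞ α(y)dy/y`. Then the additive Fourier
Transform of `P'(α)` is `P'(I(α))` with `I(α)(y) = α(1/y)/|y|`." (Printed proof: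
`𝓕P' = 𝓕IPI = P𝓕II = P𝓕 = IP = P'I` on the inverse Mellin transforms of Schwartz functions of the
critical line, TeX l. 1298–1340.) RH-FREE. [cite: Burnol2004, Thm 4.4 (TeX l. 1287)] -/
def Burnol2004_thm_4_4 : Prop :=
  ∀ α : ℝ → ℂ, IsTestAway α → 𝓕 (coSum α) = coSum (inv α)

/-- **Burnol 2004, Theorem 4.5** (TeX l. 1415, "proven jointly with Luis Báez-Duarte") **and
Theorem 4.6** (TeX l. 1504, "proven jointly with Bernard Candelpergher"; printed with the
identical statement and a second, Euler–Maclaurin, proof): "Let `g(t)` be an (even) function of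
class `C²` which has compact support away from the origin. Then both `Σ_{n≥1} g(t/n)/n −
∫_0^∞ g(u)du/u` and `Σ_{n≥1} g(n/t)/t − ∫_0^∞ g(u)du` are continuous `L¹`-functions and the
co-Poisson intertwining formula `𝓕(Σ_{n≥1} g(t/n)/n − ∫_0^∞ g(u)du/u) = Σ_{n≥1} g(n/t)/t −
∫_0^∞ g(u)du` holds as a pointwise equality and may be established as a corollary to the
Euler–McLaurin summation formulae." RH-FREE.
[cite: Burnol2004, Thm 4.5 (TeX l. 1415) and Thm 4.6 (TeX l. 1504)] -/
def Burnol2004_thm_4_5 : Prop :=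
  ∀ g : ℝ → ℂ, IsTestAway2 g →
    Continuous (coSum g) ∧ Integrable (coSum g) ∧
    Continuous (coSumDual g) ∧ Integrable (coSumDual g) ∧
    ∀ t : ℝ, 𝓕 (coSum g) t = coSumDual g t

/-! ## §5: Báez-Duarte's operators on the spectral side (Thm 5.3) -/

/-- Burnol's spectral function `V(s) = (ζ(1−s)/ζ(s))·(s/(1−s))³` of the invariant operator
`V = (−L)³𝓕₊I = UL²` (Note 5.2, TeX l. 1923–1937; proof of Thm 5.3, TeX l. 1990), written with
`ζ(1−s)/ζ(s) = Γ_ℝ(s)/Γ_ℝ(1−s) = BurnolVectors.gammaRatio s` so that it is defined at the zeros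
of `ζ` as well (`burnolV3_eq` below). (The tree's `BurnolVectors.burnolV` is the variant with the
exponent `6`.) [cite: Burnol2004, Note 5.2 (TeX l. 1923) and Thm 5.3 (TeX l. 1977)] -/
def burnolV3 (s : ℂ) : ℂ :=
  BurnolVectors.gammaRatio s * (s / (1 - s)) ^ 3

/-- In the critical strip, off the zeros of `ζ`, `V(s) = (ζ(1−s)/ζ(s)) (s/(1−s))³` as printed.
[cite: Burnol2004, Thm 5.3 (TeX l. 1990)] -/
theorem burnolV3_eq {s : ℂ} (hs0 : 0 < s.re) (hs1 : s.re < 1) (hζ : riemannZeta s ≠ 0) :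
    burnolV3 s = riemannZeta (1 - s) / riemannZeta s * (s / (1 - s)) ^ 3 := by
  rw [burnolV3, BurnolVectors.riemannZeta_one_sub_eq hs0 hs1, mul_div_cancel_right₀ _ hζ]

/-- **Burnol 2004, Theorem 5.3** (TeX l. 1977), spectral form: "The real unitary operator `IV`
satisfies `(IV)² = 1`." Printed proof (TeX l. 1988–1993): "This is clear from the spectral
representation `V(s) = (ζ(1−s)/ζ(s))(s/(1−s))³` which shows that `IVI = V^*`." On the Mellin side
`I` acts by `s ↦ 1 − s` and `V` by multiplication by `V(s)`, so `(IV)² = 1` is the identity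
`V(1−s)V(s) = 1` together with `|V(s)| = 1` on `Re s = 1/2` (unitarity); both are proved here.
The realisation of `I`, `𝓕₊`, `L`, `V` as operators on `L²(0,∞)` is not constructed in this file.
RH-FREE. [cite: Burnol2004, Thm 5.3 (TeX l. 1977)] -/
theorem Burnol2004_thm_5_3_spectral (τ : ℝ) :
    burnolV3 (1 - ((1 / 2 : ℂ) + τ * I)) * burnolV3 ((1 / 2 : ℂ) + τ * I) = 1 ∧
      ‖burnolV3 ((1 / 2 : ℂ) + τ * I)‖ = 1 := by
  set s : ℂ := (1 / 2 : ℂ) + τ * I with hs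
  have hre : s.re = 1 / 2 := by simp [hs]
  have hre' : (1 - s).re = 1 / 2 := by simp [hs]; norm_num
  have hG : Gammaℝ s ≠ 0 := Gammaℝ_ne_zero_of_re_pos (by rw [hre]; norm_num)
  have hG' : Gammaℝ (1 - s) ≠ 0 := Gammaℝ_ne_zero_of_re_pos (by rw [hre']; norm_num)
  have hs0 : s ≠ 0 := fun h ↦ by simp [h] at hre
  have hs1 : 1 - s ≠ 0 := fun h ↦ by simp [h] at hre'
  refine ⟨?_, ?_⟩
  · simp only [burnolV3, BurnolVectors.gammaRatio, sub_sub_cancel]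
    field_simp
  · have h1 : ‖BurnolVectors.gammaRatio s‖ = 1 := BurnolVectors.norm_gammaRatio_line τ
    have h2 : ‖s / (1 - s)‖ = 1 := by
      rw [norm_div, BurnolVectors.one_sub_eq_conj, RCLike.norm_conj, div_self]
      exact norm_ne_zero_iff.2 hs0
    rw [burnolV3, norm_mul, norm_pow, h1, h2, one_pow, mul_one]

end Literature.NumberTheory.LFunctions
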